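import Mathlib
import Summits.NavierStokesRegularity.NavierStokesRegularity.Theorems.FilamentSkeletonRssStadiumPartnerPiece
import Summits.NavierStokesRegularity.NavierStokesRegularity.Theorems.FilamentSkeletonRssStadiumKernelPieces

/-!
# The partner piece AGREES with the stub's real Biot–Savart integrand on the real trace (`TangentSkeletonNearStraightL`,
# stmt-NavierStokesRegularity-23320, registered stub `stub_stripPropagation`, `k ≠ j` summands)

Complement to `Theorems.StadiumPartnerPiece` (holomorphy + bound of the complexified partner integral): at a REAL point `t` of the trace,
the complexified integral equals the complexification of the stub's real integral
`∫σ ((‖X t − Y σ‖² + κ·A σ)^{3/2})⁻¹ • cross (Y′ σ) (X t − Y σ)` (the `k`-th summand of `u X (X j t)` in `StripPropagation`, without its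
scalar prefactor `Γγ_k/4π`).  Ingredients: `F t = cplx (X t)` on the trace; the real kernel identities `((r:ℂ)^{3/2})⁻¹ = ((r^{3/2})⁻¹ : ℝ)`
and `cplx (cross a b) = cplx a ⨯₃ cplx b` (Theorems.StadiumKernelPieces); the complexification `ℝ³ →L[ℝ] ℂ³` (a local `ContinuousLinearMap.pi`, no new definition) commutes with the
Bochner integral (`ContinuousLinearMap.integral_comp_comm`) — which needs INTEGRABILITY of the real integrand, supplied by continuity and the
Lorentzian majorant `1/d² ≤ 5((7/16)²(σ−σ₀)² + a²)⁻¹` (near-infimum source point, chord `≥ 7/8`, Theorems.StadiumFarMajorant).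
So, per partner `k ≠ j`, the three clauses of `StadiumAnalyticBdd` (holomorphy, real agreement, bound) are available on the quarter-width stadium
AS REGISTERED.  HONEST FRAMING: a tool for a HYPOTHETICAL filament skeleton on the NEGATIVE side of a MODEL route; nothing here bears on
Navier–Stokes regularity or blow-up.  `--supports stmt-NavierStokesRegularity-23320`.
-/

set_option linter.dupNamespace false

noncomputable section

namespace Summit.NavierStokesRegularity.NavierStokesRegularity.Theorems.StadiumPartnerReal

open Set Metric MeasureTheory
open scoped InnerProductSpace Matrix
open Literature.Analysis.FluidPDE
open Summit.NavierStokesRegularity.NavierStokesRegularity.Theorems.StadiumFarMajorant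
open Summit.NavierStokesRegularity.NavierStokesRegularity.Theorems.NearStraightEscape
open Summit.NavierStokesRegularity.NavierStokesRegularity.Theorems.StadiumKernelPieces
open Summit.NavierStokesRegularity.NavierStokesRegularity.Theorems.StadiumDeviationPackage
open Summit.NavierStokesRegularity.NavierStokesRegularity.Theorems.StadiumPartnerPiece

/-- `Σᵢ vᵢ² = ‖v‖²` in coordinates. [folklore] -/
theorem sum_sq_apply_eq_norm_sq (v : EuclideanSpace ℝ (Fin 3)) : ∑ i, (v i) ^ 2 = ‖v‖ ^ 2 := by
  rw [EuclideanSpace.norm_eq, Real.sq_sqrt (Finset.sum_nonneg fun i _ => sq_nonneg _)]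
  simp [Real.norm_eq_abs, sq_abs]

/-- **The complexified kernel at a real target is the complexification of the real kernel.** [folklore] -/
theorem kernel_real (y : EuclideanSpace ℝ (Fin 3)) (Y : ℝ → EuclideanSpace ℝ (Fin 3)) {κ : ℝ} {A : ℝ → ℝ}
    (hκ : 0 ≤ κ) (hA : ∀ σ, 0 ≤ A σ) (σ : ℝ) :
    (((∑ i, ((((y i : ℝ) : ℂ)) - ((Y σ i : ℝ) : ℂ)) ^ 2) + ((κ * A σ : ℝ) : ℂ)) ^ ((3:ℂ) / 2))⁻¹ •
        ((fun i => ((deriv Y σ i : ℝ) : ℂ)) ⨯₃ (fun i => (((y i : ℝ) : ℂ)) - ((Y σ i : ℝ) : ℂ))) =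
      fun i => (((((‖y - Y σ‖ ^ 2 + κ * A σ) ^ (3/2 : ℝ))⁻¹ • cross (deriv Y σ) (y - Y σ)) i : ℝ) : ℂ) := by
  -- the difference vector in coordinates
  have hdiff : (fun i => (((y i : ℝ) : ℂ)) - ((Y σ i : ℝ) : ℂ)) = fun i => (((y - Y σ) i : ℝ) : ℂ) := by
    funext i; simp [PiLp.sub_apply, Complex.ofReal_sub]
  have hsum : (∑ i, ((((y i : ℝ) : ℂ)) - ((Y σ i : ℝ) : ℂ)) ^ 2) = (((‖y - Y σ‖ ^ 2 : ℝ)) : ℂ) := by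
    rw [← sum_sq_apply_eq_norm_sq]
    push_cast
    refine Finset.sum_congr rfl fun i _ => ?_
    simp [PiLp.sub_apply]
  have hbase : (∑ i, ((((y i : ℝ) : ℂ)) - ((Y σ i : ℝ) : ℂ)) ^ 2) + ((κ * A σ : ℝ) : ℂ) =
      (((‖y - Y σ‖ ^ 2 + κ * A σ : ℝ)) : ℂ) := by
    rw [hsum]; push_cast; ring
  have hr : 0 ≤ ‖y - Y σ‖ ^ 2 + κ * A σ := by have := hA σ; positivity
  rw [hbase, inv_cpow_threeHalves_ofReal hr, hdiff]
  -- the cross product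
  have hcross : (fun i => ((deriv Y σ i : ℝ) : ℂ)) ⨯₃ (fun i => (((y - Y σ) i : ℝ) : ℂ)) =
      fun i => (((cross (deriv Y σ) (y - Y σ)) i : ℝ) : ℂ) := by
    have h := cplx_cross (deriv Y σ) (y - Y σ)
    simp only [inner_single_eq] at h
    exact h.symm
  rw [hcross]
  funext i
  simp [Pi.smul_apply, smul_eq_mul]

/-- **Integrability of the stub's real partner integrand** at a point `y = X t` of filament `j` (separation `d₀ > 0`, partner unit speed with
tangent oscillation `≤ 1/2`, continuous nonnegative core). [folklore] -/
theorem integrable_real_kernel {X Y : ℝ → EuclideanSpace ℝ (Fin 3)} (hY : ContDiff ℝ 1 Y) (hYu : ∀ σ, ‖deriv Y σ‖ = 1)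
    (hYosc : ∀ τ σ, ‖deriv Y τ - deriv Y σ‖ ≤ 1 / 2) {A : ℝ → ℝ} (hAc : Continuous A) (hA : ∀ σ, 0 ≤ A σ) {κ d₀ : ℝ}
    (hκ : 0 ≤ κ) (hd₀ : 0 < d₀) (hsep : ∀ τ σ, d₀ ≤ ‖X τ - Y σ‖) (t : ℝ) :
    Integrable fun σ : ℝ => ((‖X t - Y σ‖ ^ 2 + κ * A σ) ^ (3/2 : ℝ))⁻¹ • cross (deriv Y σ) (X t - Y σ) := by
  have hYc : Continuous Y := hY.continuous
  have hdYc : Continuous (deriv Y) := hY.continuous_deriv le_rfl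
  have hYd : Differentiable ℝ Y := hY.differentiable (by simp)
  -- continuity of the integrand
  have hbase_pos : ∀ σ, 0 < ‖X t - Y σ‖ ^ 2 + κ * A σ := by
    intro σ
    have h1 : 0 < ‖X t - Y σ‖ := lt_of_lt_of_le hd₀ (hsep t σ)
    have := hA σ
    positivity
  have hcont : Continuous fun σ : ℝ => ((‖X t - Y σ‖ ^ 2 + κ * A σ) ^ (3/2 : ℝ))⁻¹ • cross (deriv Y σ) (X t - Y σ) := by
    have hb : Continuous fun σ : ℝ => ‖X t - Y σ‖ ^ 2 + κ * A σ :=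
      ((continuous_const.sub hYc).norm.pow 2).add (continuous_const.mul hAc)
    have hp : Continuous fun σ : ℝ => (‖X t - Y σ‖ ^ 2 + κ * A σ) ^ (3/2 : ℝ) :=
      hb.rpow_const fun σ => Or.inr (by norm_num)
    have hi : Continuous fun σ : ℝ => ((‖X t - Y σ‖ ^ 2 + κ * A σ) ^ (3/2 : ℝ))⁻¹ :=
      hp.inv₀ fun σ => (Real.rpow_pos_of_pos (hbase_pos σ) _).ne'
    have hc : Continuous fun σ : ℝ => cross (deriv Y σ) (X t - Y σ) := by
      have hsub : Continuous fun σ : ℝ => X t - Y σ := continuous_const.sub hYc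
      have h : Continuous ((Function.uncurry fun x y => crossCLM x y) ∘ fun σ => (deriv Y σ, X t - Y σ)) :=
        crossCLM.continuous₂.comp (hdYc.prodMk hsub)
      exact h
    exact hi.smul hc
  -- the Lorentzian majorant (near-infimum source point)
  set D : ℝ → ℝ := fun σ => ‖X t - Y σ‖ with hD
  have hDge : ∀ σ, d₀ ≤ D σ := fun σ => hsep _ _
  have hbdd : BddBelow (range D) := ⟨d₀, by rintro _ ⟨σ, rfl⟩; exact hDge σ⟩
  set m : ℝ := ⨅ σ, D σ with hm
  have hm_ge : d₀ ≤ m := le_ciInf hDge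
  have hm_pos : 0 < m := lt_of_lt_of_le hd₀ hm_ge
  have hm_le : ∀ σ, m ≤ D σ := fun σ => ciInf_le hbdd σ
  obtain ⟨σ₀, hσ₀⟩ : ∃ σ₀, D σ₀ < 2 * m := exists_lt_of_ciInf_lt (by linarith)
  have hmaj : ∀ σ, ‖((‖X t - Y σ‖ ^ 2 + κ * A σ) ^ (3/2 : ℝ))⁻¹ • cross (deriv Y σ) (X t - Y σ)‖ ≤
      5 * 1 * ((7 / 16) ^ 2 * (σ - σ₀) ^ 2 + m ^ 2)⁻¹ := by
    intro σ
    have hDpos : 0 < D σ := lt_of_lt_of_le hd₀ (hDge σ)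
    -- `‖kernel‖ ≤ 1/D²`
    have h1 : ‖((‖X t - Y σ‖ ^ 2 + κ * A σ) ^ (3/2 : ℝ))⁻¹ • cross (deriv Y σ) (X t - Y σ)‖ ≤ 1 / D σ ^ 2 := by
      rw [norm_smul, norm_inv, Real.norm_eq_abs, abs_of_pos (Real.rpow_pos_of_pos (hbase_pos σ) _)]
      have hc : ‖cross (deriv Y σ) (X t - Y σ)‖ ≤ D σ := by
        rw [norm_cross, hYu σ, one_mul]
        have h := Real.sin_le_one (InnerProductGeometry.angle (deriv Y σ) (X t - Y σ))
        have h0 : 0 ≤ ‖X t - Y σ‖ := norm_nonneg _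
        simp only [hD]
        nlinarith
      have hp : D σ ^ 3 ≤ (‖X t - Y σ‖ ^ 2 + κ * A σ) ^ (3/2 : ℝ) := by
        have hD2 : D σ ^ 2 ≤ ‖X t - Y σ‖ ^ 2 + κ * A σ := by
          have := hA σ; simp only [hD]; nlinarith
        calc D σ ^ 3 = (D σ ^ 2) ^ (3/2 : ℝ) := by
              rw [← Real.rpow_natCast (D σ) 3, ← Real.rpow_natCast (D σ) 2, ← Real.rpow_mul hDpos.le]; norm_num
          _ ≤ (‖X t - Y σ‖ ^ 2 + κ * A σ) ^ (3/2 : ℝ) := Real.rpow_le_rpow (by positivity) hD2 (by norm_num)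
      have hp0 : 0 < (‖X t - Y σ‖ ^ 2 + κ * A σ) ^ (3/2 : ℝ) := Real.rpow_pos_of_pos (hbase_pos σ) _
      rw [one_div]
      calc ((‖X t - Y σ‖ ^ 2 + κ * A σ) ^ (3/2 : ℝ))⁻¹ * ‖cross (deriv Y σ) (X t - Y σ)‖
          ≤ (D σ ^ 3)⁻¹ * D σ := mul_le_mul (inv_anti₀ (by positivity) hp) hc (norm_nonneg _) (by positivity)
        _ = (D σ ^ 2)⁻¹ := by field_simp
    -- Lorentzian
    have hchord : 7 / 8 * |σ - σ₀| ≤ ‖Y σ - Y σ₀‖ := chord_ge_seven_eighths hYd hYu hYosc le_rfl σ₀ σ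
    have hDlow : 7 / 8 * |σ - σ₀| - 2 * m ≤ D σ := by
      have h2 : ‖Y σ - Y σ₀‖ ≤ D σ + D σ₀ := by
        have := norm_sub_le_norm_sub_add_norm_sub (Y σ) (X t) (Y σ₀)
        simp only [hD]
        rw [norm_sub_rev (Y σ) (X t)] at this
        linarith
      linarith
    have h2 : 7 / 16 * |σ - σ₀| - m ≤ D σ := by
      rcases le_or_gt m (7 / 16 * |σ - σ₀|) with h | h
      · linarith
      · linarith [hm_le σ, abs_nonneg (σ - σ₀)]
    have h3 := far_majorant_le (C := 1) (σ₀ := σ₀) (σ := σ) hm_pos (by norm_num : (0:ℝ) ≤ 7 / 16) (by norm_num) (hm_le σ) h2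
    exact h1.trans h3
  have hint : Integrable (fun σ : ℝ => 5 * 1 * ((7 / 16) ^ 2 * (σ - σ₀) ^ 2 + m ^ 2)⁻¹) :=
    (integrable_lorentzian hm_pos (by norm_num : (7 / 16 : ℝ) ≠ 0) σ₀).const_mul _
  exact hint.mono' hcont.aestronglyMeasurable (Filter.Eventually.of_forall hmaj)

/-- **Real agreement of the partner piece.**  On the real trace (`t` with `|t − cc| < L + hs`, so `F t = cplx (X t)`), the complexified partner
integral equals the coordinatewise complexification of the stub's real Biot–Savart summand (without its scalar prefactor). [folklore] -/
theorem partnerPiece_real {hs L cc d₀ κ : ℝ} {F : ℂ → (Fin 3 → ℂ)} {X : ℝ → EuclideanSpace ℝ (Fin 3)}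
    (hFX : ∀ r : ℝ, (r : ℂ) ∈ {z : ℂ | |z.im| < hs ∧ |z.re - cc| < L + hs} →
      F r = fun i => ((⟪X r, EuclideanSpace.single i (1:ℝ)⟫_ℝ : ℝ) : ℂ))
    {Y : ℝ → EuclideanSpace ℝ (Fin 3)} (hY : ContDiff ℝ 1 Y) (hYu : ∀ σ, ‖deriv Y σ‖ = 1)
    (hYosc : ∀ τ σ, ‖deriv Y τ - deriv Y σ‖ ≤ 1 / 2) {A : ℝ → ℝ} (hAc : Continuous A) (hA : ∀ σ, 0 ≤ A σ) (hκ : 0 ≤ κ)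
    (hd₀ : 0 < d₀) (hsep : ∀ τ σ, d₀ ≤ ‖X τ - Y σ‖) (hhs : 0 < hs) {t : ℝ} (ht : |t - cc| < L + hs) :
    (∫ σ : ℝ, (((∑ i, (F t i - ((Y σ i : ℝ) : ℂ)) ^ 2) + ((κ * A σ : ℝ) : ℂ)) ^ ((3:ℂ) / 2))⁻¹ •
        ((fun i => ((deriv Y σ i : ℝ) : ℂ)) ⨯₃ (fun i => F t i - ((Y σ i : ℝ) : ℂ)))) =
      fun i => (((∫ σ : ℝ, ((‖X t - Y σ‖ ^ 2 + κ * A σ) ^ (3/2 : ℝ))⁻¹ • cross (deriv Y σ) (X t - Y σ)) i : ℝ) : ℂ) := by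
  -- the complexification as a real-linear continuous map (local, so that no definition is introduced)
  set Lc : EuclideanSpace ℝ (Fin 3) →L[ℝ] (Fin 3 → ℂ) :=
    ContinuousLinearMap.pi fun i => Complex.ofRealCLM.comp (EuclideanSpace.proj i) with hLc
  have hLc_apply : ∀ v : EuclideanSpace ℝ (Fin 3), Lc v = fun i => ((v i : ℝ) : ℂ) := by
    intro v; funext i; simp [hLc]
  have htS : ((t : ℝ) : ℂ) ∈ {z : ℂ | |z.im| < hs ∧ |z.re - cc| < L + hs} := ⟨by simpa using hhs, by simpa using ht⟩
  have hFt : ∀ i, F t i = ((X t i : ℝ) : ℂ) := by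
    intro i; rw [hFX t htS]; simp only [inner_single_eq]
  have hpt : ∀ σ, (((∑ i, (F t i - ((Y σ i : ℝ) : ℂ)) ^ 2) + ((κ * A σ : ℝ) : ℂ)) ^ ((3:ℂ) / 2))⁻¹ •
        ((fun i => ((deriv Y σ i : ℝ) : ℂ)) ⨯₃ (fun i => F t i - ((Y σ i : ℝ) : ℂ))) =
      Lc (((‖X t - Y σ‖ ^ 2 + κ * A σ) ^ (3/2 : ℝ))⁻¹ • cross (deriv Y σ) (X t - Y σ)) := by
    intro σ
    have h := kernel_real (X t) Y hκ hA σ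
    simp only [← hFt] at h
    rw [hLc_apply]
    exact h
  simp_rw [hpt]
  rw [Lc.integral_comp_comm (integrable_real_kernel hY hYu hYosc hAc hA hκ hd₀ hsep t), hLc_apply]

end Summit.NavierStokesRegularity.NavierStokesRegularity.Theorems.StadiumPartnerReal

end
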